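import Literature.Probability.RandomPlanarGeometry.SAWCount
import Mathlib.Analysis.SpecificLimits.Normed
import HarnessLib

/-!
# Self-avoiding walk on `ℤ^d`: the radius of convergence of `χ` and the bound `χ(z) ≥ z_c/(z_c - z)`

Topic `Literature/Probability/RandomPlanarGeometry` (next to `BDGS2012.lean` and `SAWCount.lean`,
whose `count d n = cₙ`, `connectiveConstant d = μ = infₙ cₙ^{1/n}`, `criticalPoint d = z_c = 1/μ`,
`susceptibility d 1 z = χ(z) = Σₙ cₙ zⁿ` and `count_add_le : c_{n+m} ≤ cₙ cₘ` are used).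
Sources: Bauerschmidt–Duminil-Copin–Goodman–Slade 2012, §1.5.3; Madras–Slade 1993, §1.2–§1.3
and §1.5, eq. (1.5.1).

PROVED here (namespace `Literature.SAW.Zd`, all `theorem`s):
* `count_mul_add_le` — `c_{qM+r} ≤ c_M^q c_r` (iterated submultiplicativity);
* `exists_count_mul_pow_lt_one`, `exists_bound_count_mul_pow`, `exists_geometric_bound` — for
  `0 < z < z_c` some `c_M z^M < 1`, hence `cₙ zⁿ` is bounded, hence `cₙ zⁿ ≤ K ρⁿ` with `ρ < 1`
  (the root test done by hand from the definition of `μ` as an infimum);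
* `summable_pow_mul_count_mul_pow`, `summable_count_mul_pow` — `Σ nᵏ cₙ zⁿ < ∞` for
  `0 ≤ z < z_c`;
* `BDGS2012_susceptibility_radius_holds` — **discharge** of the named fact
  `BDGS2012_susceptibility_radius` (`Σ cₙ zⁿ` converges for `0 ≤ z < z_c`, diverges for `z > z_c`,
  `d ≥ 1`; the divergence half is `not_summable_of_criticalPoint_lt` of `BDGS2012.lean`);
* `criticalPoint_div_le_susceptibility` — the **mean-field bound `χ(z) ≥ z_c/(z_c - z)`** for
  `0 < z < z_c` (Madras–Slade (1.3.6) = (1.5.1): `χ(z) = Σ cₙ zⁿ ≥ Σ (μz)ⁿ`, from `cₙ ≥ μⁿ`,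
  `pow_connectiveConstant_le_count`);
* `one_le_susceptibility`, `susceptibility_mono` — `χ ≥ 1` and `χ` is non-decreasing on `[0, z_c)`.
-/

noncomputable section

open Filter Topology Literature.Probability.LatticeModels Literature.Probability.Percolation Finset
open scoped BigOperators

namespace Literature.Probability.RandomPlanarGeometry.SAW.Zd

variable {d : ℕ}

/-! ### Iterated submultiplicativity -/

/-- Iterated submultiplicativity: `c_{qM + r} ≤ c_M^q · c_r`. [cite: MadrasSlade1993, §1.2, eq. (1.2.3)] -/
private theorem count_mul_add_le (d M r : ℕ) : ∀ q : ℕ, count d (q * M + r) ≤ count d M ^ q * count d r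
  | 0 => by simp
  | q + 1 => by
    calc count d ((q + 1) * M + r) = count d (M + (q * M + r)) := by ring_nf
      _ ≤ count d M * count d (q * M + r) := count_add_le d M _
      _ ≤ count d M * (count d M ^ q * count d r) := Nat.mul_le_mul_left _ (Literature.Probability.RandomPlanarGeometry.SAW.Zd.count_mul_add_le d M r q)
      _ = count d M ^ (q + 1) * count d r := by ring

/-! ### Below `z_c`: geometric bounds on `cₙ zⁿ` and convergence of `χ` (BDGS §1.5.3) -/

/-- For `0 < z < z_c = 1/μ` there is `M ≥ 1` with `c_M z^M < 1` (definition of `μ` as the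
infimum of `cₙ^{1/n}`). [cite: BDGS2012, §1.5.3] -/
theorem exists_count_mul_pow_lt_one {z : ℝ} (hz : 0 < z) (hzc : z < criticalPoint d) :
    ∃ M : ℕ, 0 < M ∧ (count d M : ℝ) * z ^ M < 1 := by
  have hzc0 : 0 < criticalPoint d := hz.trans hzc
  have hμ : 0 < connectiveConstant d := inv_pos.1 hzc0
  have hlt : connectiveConstant d < z⁻¹ := (lt_inv_comm₀ hz hμ).1 hzc
  have hb : BddBelow (Set.range fun m : ℕ => (count d (m + 1) : ℝ) ^ (1 / ((m : ℝ) + 1))) :=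
    ⟨0, by rintro _ ⟨m, rfl⟩; exact Real.rpow_nonneg (Nat.cast_nonneg _) _⟩
  rw [connectiveConstant, ciInf_lt_iff hb] at hlt
  obtain ⟨N, hN⟩ := hlt
  refine ⟨N + 1, Nat.succ_pos N, ?_⟩
  have hc0 : (0 : ℝ) ≤ count d (N + 1) := Nat.cast_nonneg _
  have hpos : (0 : ℝ) < (N : ℝ) + 1 := by positivity
  have hlt' : (count d (N + 1) : ℝ) < z⁻¹ ^ (N + 1) := by
    rw [one_div] at hN
    have h := (Real.rpow_inv_lt_iff_of_pos hc0 (inv_nonneg.2 hz.le) hpos).1 hN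
    have h' : (z⁻¹ : ℝ) ^ ((N : ℝ) + 1) = z⁻¹ ^ (N + 1) := by
      rw [← Nat.cast_succ, Real.rpow_natCast]
    rwa [h'] at h
  calc (count d (N + 1) : ℝ) * z ^ (N + 1)
      < z⁻¹ ^ (N + 1) * z ^ (N + 1) := mul_lt_mul_of_pos_right hlt' (pow_pos hz _)
    _ = 1 := by rw [← mul_pow, inv_mul_cancel₀ hz.ne', one_pow]

/-- For `0 < z < z_c` the terms `cₙ zⁿ` are bounded (by `Σ_{r<M} c_r z^r`, via
`c_{qM+r} ≤ c_M^q c_r` and `c_M z^M < 1`). [cite: BDGS2012, §1.5.3] -/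
theorem exists_bound_count_mul_pow {z : ℝ} (hz : 0 < z) (hzc : z < criticalPoint d) :
    ∃ K : ℝ, ∀ n, (count d n : ℝ) * z ^ n ≤ K := by
  obtain ⟨M, hM, hρ⟩ := exists_count_mul_pow_lt_one hz hzc
  refine ⟨∑ r ∈ Finset.range M, (count d r : ℝ) * z ^ r, fun n => ?_⟩
  obtain ⟨q, r, hr, rfl⟩ : ∃ q r, r < M ∧ n = q * M + r :=
    ⟨n / M, n % M, Nat.mod_lt n hM, by rw [Nat.mul_comm]; exact (Nat.div_add_mod n M).symm⟩
  have h1 : (count d (q * M + r) : ℝ) ≤ (count d M : ℝ) ^ q * count d r := by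
    exact_mod_cast Literature.Probability.RandomPlanarGeometry.SAW.Zd.count_mul_add_le d M r q
  have hρ0 : 0 ≤ (count d M : ℝ) * z ^ M := by positivity
  calc (count d (q * M + r) : ℝ) * z ^ (q * M + r)
      ≤ (count d M : ℝ) ^ q * count d r * z ^ (q * M + r) :=
        mul_le_mul_of_nonneg_right h1 (pow_nonneg hz.le _)
    _ = ((count d M : ℝ) * z ^ M) ^ q * ((count d r : ℝ) * z ^ r) := by
        rw [pow_add, mul_comm q M, pow_mul, mul_pow]; ring
    _ ≤ 1 ^ q * ((count d r : ℝ) * z ^ r) := by gcongr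
    _ = (count d r : ℝ) * z ^ r := by rw [one_pow, one_mul]
    _ ≤ ∑ r ∈ Finset.range M, (count d r : ℝ) * z ^ r :=
        Finset.single_le_sum (f := fun r => (count d r : ℝ) * z ^ r) (fun i _ => by positivity)
          (Finset.mem_range.2 hr)

/-- For `0 < z < z_c`, `cₙ zⁿ ≤ K ρⁿ` for some `K ≥ 0` and `0 < ρ < 1` (compare with the
midpoint `w = (z + z_c)/2`). [cite: BDGS2012, §1.5.3] -/
private theorem exists_geometric_bound {z : ℝ} (hz : 0 < z) (hzc : z < criticalPoint d) :
    ∃ K ρ : ℝ, 0 ≤ K ∧ 0 < ρ ∧ ρ < 1 ∧ ∀ n, (count d n : ℝ) * z ^ n ≤ K * ρ ^ n := by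
  set w := (z + criticalPoint d) / 2 with hw_def
  have hw : z < w := by rw [hw_def]; linarith
  have hwc : w < criticalPoint d := by rw [hw_def]; linarith
  have hw0 : 0 < w := hz.trans hw
  obtain ⟨K, hK⟩ := exists_bound_count_mul_pow hw0 hwc
  have hK0 : 0 ≤ K := le_trans (by positivity) (hK 0)
  refine ⟨K, z / w, hK0, div_pos hz hw0, (div_lt_one hw0).2 hw, fun n => ?_⟩
  have hzw : z = w * (z / w) := by field_simp
  calc (count d n : ℝ) * z ^ n = (count d n : ℝ) * w ^ n * (z / w) ^ n := by
        conv_lhs => rw [hzw]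
        rw [mul_pow, mul_assoc]
    _ ≤ K * (z / w) ^ n := mul_le_mul_of_nonneg_right (hK n) (by positivity)

/-- For `0 < z < z_c` and every `k`, `Σ nᵏ cₙ zⁿ < ∞`. [cite: BDGS2012, §1.5.3] -/
private theorem summable_pow_mul_count_mul_pow (k : ℕ) {z : ℝ} (hz : 0 < z) (hzc : z < criticalPoint d) :
    Summable fun n : ℕ => (n : ℝ) ^ k * ((count d n : ℝ) * z ^ n) := by
  obtain ⟨K, ρ, hK, hρ0, hρ1, hb⟩ := Literature.Probability.RandomPlanarGeometry.SAW.Zd.exists_geometric_bound hz hzc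
  have hs : Summable fun n : ℕ => K * ((n : ℝ) ^ k * ρ ^ n) :=
    (summable_pow_mul_geometric_of_norm_lt_one k (by rwa [Real.norm_of_nonneg hρ0.le])).mul_left K
  refine Summable.of_nonneg_of_le (fun n => by positivity) (fun n => ?_) hs
  calc (n : ℝ) ^ k * ((count d n : ℝ) * z ^ n) ≤ (n : ℝ) ^ k * (K * ρ ^ n) :=
        mul_le_mul_of_nonneg_left (hb n) (by positivity)
    _ = K * ((n : ℝ) ^ k * ρ ^ n) := by ring

/-- For `0 ≤ z < z_c`, `Σ cₙ zⁿ < ∞`. [cite: BDGS2012, §1.5.3] -/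
private theorem summable_count_mul_pow {z : ℝ} (hz : 0 ≤ z) (hzc : z < criticalPoint d) :
    Summable fun n : ℕ => (count d n : ℝ) * z ^ n := by
  rcases hz.eq_or_lt with rfl | hz'
  · refine summable_of_ne_finset_zero (s := {0}) fun n hn => ?_
    rw [Finset.mem_singleton] at hn
    simp [hn]
  · simpa using Literature.Probability.RandomPlanarGeometry.SAW.Zd.summable_pow_mul_count_mul_pow 0 hz' hzc

/-- **Discharge of `BDGS2012_susceptibility_radius`**: the radius of convergence of
`χ(z) = Σ cₙ zⁿ` is `z_c = 1/μ`. [cite: BDGS2012, §1.5.3] -/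
private theorem BDGS2012_susceptibility_radius_holds : BDGS2012_susceptibility_radius := by
  intro d hd z hz
  haveI : NeZero d := ⟨by omega⟩
  exact ⟨fun hzc => Literature.Probability.RandomPlanarGeometry.SAW.Zd.summable_count_mul_pow hz hzc,
    fun hzc => not_summable_of_criticalPoint_lt (connectiveConstant_pos d) hzc⟩

/-! ### The mean-field lower bound `χ(z) ≥ z_c/(z_c - z)` (Madras–Slade (1.3.6) = (1.5.1)) -/

/-- **`χ(z) ≥ z_c/(z_c - z)` for `0 < z < z_c`**: `χ(z) = Σ cₙ zⁿ ≥ Σ (μz)ⁿ = 1/(1 - μz)`.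
[cite: MadrasSlade1993, §1.5, eq. (1.5.1)] -/
private theorem criticalPoint_div_le_susceptibility {z : ℝ} (hz : 0 < z) (hzc : z < criticalPoint d) :
    criticalPoint d / (criticalPoint d - z) ≤ susceptibility d 1 z := by
  have hzc0 : 0 < criticalPoint d := hz.trans hzc
  have hμ : 0 < connectiveConstant d := inv_pos.1 hzc0
  have hμz : connectiveConstant d * z < 1 := by
    calc connectiveConstant d * z < connectiveConstant d * criticalPoint d :=
          mul_lt_mul_of_pos_left hzc hμ
      _ = 1 := mul_inv_cancel₀ hμ.ne'
  have hμz0 : 0 ≤ connectiveConstant d * z := by positivity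
  have hgeo := hasSum_geometric_of_lt_one hμz0 hμz
  have key : criticalPoint d / (criticalPoint d - z) = (1 - connectiveConstant d * z)⁻¹ := by
    rw [criticalPoint, inv_eq_one_div, inv_eq_one_div]
    field_simp
  rw [key, ← hgeo.tsum_eq, susceptibility_one]
  refine Summable.tsum_le_tsum (fun n => ?_) hgeo.summable (Literature.Probability.RandomPlanarGeometry.SAW.Zd.summable_count_mul_pow hz.le hzc)
  rw [mul_pow]
  exact mul_le_mul_of_nonneg_right (pow_connectiveConstant_le_count d n) (pow_nonneg hz.le n)

/-- `χ(z) ≥ 1` for `0 ≤ z < z_c` (the term `c₀ z⁰ = 1`). [folklore] -/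
private theorem one_le_susceptibility {z : ℝ} (hz : 0 ≤ z) (hzc : z < criticalPoint d) :
    1 ≤ susceptibility d 1 z := by
  rw [susceptibility_one]
  have h := (Literature.Probability.RandomPlanarGeometry.SAW.Zd.summable_count_mul_pow hz hzc).le_tsum 0 (fun n _ => by positivity)
  simpa [count_zero] using h

/-- `χ` is non-decreasing on `[0, z_c)`. [folklore] -/
private theorem susceptibility_mono {z z' : ℝ} (hz : 0 ≤ z) (hzz' : z ≤ z') (hzc : z' < criticalPoint d) :
    susceptibility d 1 z ≤ susceptibility d 1 z' := by
  rw [susceptibility_one, susceptibility_one]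
  refine Summable.tsum_le_tsum (fun n => ?_) (Literature.Probability.RandomPlanarGeometry.SAW.Zd.summable_count_mul_pow hz (hzz'.trans_lt hzc))
    (Literature.Probability.RandomPlanarGeometry.SAW.Zd.summable_count_mul_pow (hz.trans hzz') hzc)
  exact mul_le_mul_of_nonneg_left (pow_le_pow_left₀ hz hzz' n) (Nat.cast_nonneg _)

end Literature.Probability.RandomPlanarGeometry.SAW.Zd
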